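import Summits.CriticalPhenomena.PercolationContinuityZ3.Theorems.PercNearOneGluingNoHeavyLowerTailSectorTransfer
import HarnessLib

/-!
# `NoHeavyLowerTail` (stmt-CriticalPhenomena-4575) — three relays: the two registered stubs close the rung (gen 5, `nh-dp-commonrelay`)

Support file (`--supports stmt-CriticalPhenomena-4575`); no definitions, no named facts, no sorries.  The statements of the two stubs
registered on stmt-4575 by this seat — `stub_sigmaThreeRelays` (the hypothesis-free row `Σ₁`) and `stub_sectorClaimIpsi` (sector piece (I) =
CLAIM-I-ψ) — are taken VERBATIM as hypotheses (`hSigma`, `hI` below, universally quantified exactly as registered) and shown to give the pre-FKG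
inequality (3) at the designated relay `a₃` for every three-relay configuration with `μ(all three relays separated) > 0`, i.e. Kozma–Nitzan's
Question 7 at `|A| = 3` (the first open rung of `stub_dcone`), via `preFKG3_of_claimI_sigma` (file `…SectorTransfer`; `Σ₂` is `Σ₁` at `(a₂, a₁)`).
[cite: KozmaNitzan2024, Question 7 (§5.5, p. 36), Theorem 2 (pp. 8–9)]
-/

namespace Summit.CriticalPhenomena.PercolationContinuityZ3.Theorems

open MeasureTheory Set Literature.Probability.LatticeModels Literature.Probability.Percolation

noncomputable section
open Classical

/-- **KN Question 7 at three relays from the two registered stubs.**  If `Σ₁` (`stub_sigmaThreeRelays`, hypothesis-free) and the sector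
inequality (I) (`stub_sectorClaimIpsi`) hold for all finite weighted graphs, then for all pairwise distinct `o, b, a₁, a₂, a₃` with
`τ₃ ≤ τ₁`, `τ₃ ≤ τ₂` and `μ(a₁, a₂, a₃ pairwise separated) > 0`:  `μ(o↔A, a₃↔b) ≤ μ(o↔A, o↔b)`.
[this file; cite: KozmaNitzan2024, Question 7 (p. 36)] -/
theorem preFKG3_of_stubs
    (hSigma : ∀ (n : ℕ) (w : Sym2 (Fin n) → unitInterval) (o b a₁ a₂ a₃ : Fin n), a₁ ≠ a₂ → a₁ ≠ a₃ → a₂ ≠ a₃ → o ≠ a₁ → o ≠ a₂ → o ≠ a₃ → b ≠ a₁ → b ≠ a₂ → b ≠ a₃ → o ≠ b → ((prodBernoulli w).real ((openConn a₁ a₂)ᶜ ∩ (openConn a₁ a₃)ᶜ : Set (BondConfig (Fin n))) * (prodBernoulli w).real ((openConn a₁ a₂)ᶜ ∩ (openConn a₁ a₃)ᶜ ∩ (openConn a₂ a₃)ᶜ ∩ openConn a₁ o) - (prodBernoulli w).real ((openConn a₁ a₂)ᶜ ∩ (openConn a₁ a₃)ᶜ ∩ (openConn a₂ a₃)ᶜ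 : Set (BondConfig (Fin n))) * (prodBernoulli w).real ((openConn a₁ a₂)ᶜ ∩ (openConn a₁ a₃)ᶜ ∩ openConn a₁ o)) * (prodBernoulli w).real ((openConn a₁ a₂)ᶜ ∩ (openConn a₁ a₃)ᶜ ∩ (openConn a₂ a₃)ᶜ ∩ openConn a₃ b) ≤ (prodBernoulli w).real ((openConn a₁ a₂)ᶜ ∩ (openConn a₁ a₃)ᶜ ∩ (openConn a₂ a₃)ᶜ : Set (BondConfig (Fin n))) * ((prodBernoulli w).real ((openConn a₁ a₂)ᶜ ∩ (openConn a₁ a₃)ᶜ : Set (BondConfig (Fin n))) * ((prodBernoulli w).real ((openConn a₁ a₂)ᶜ ∩ (openConn a₁ a₃)ᶜ ∩ (openConn a₁ o ∩ openConn a₁ b)) - (prodBernoulli w).real ((openConn a₁ a₂)ᶜ ∩ (openConn a₁ a₃)ᶜ ∩ (openConn a₁ o ∩ (openConn a₂ b ∩ openConn a₃ b)))) - (prodBernoulli w).real ((openConn a₁ a₂)ᶜ ∩ (openConn a₁ a₃)ᶜ ∩ openConn a₁ o) * ((prodBernoulli w).real ((openConn a₁ a₂)ᶜ ∩ (openConn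 a₁ a₃)ᶜ ∩ openConn a₁ b) - (prodBernoulli w).real ((openConn a₁ a₂)ᶜ ∩ (openConn a₁ a₃)ᶜ ∩ (openConn a₂ b ∩ openConn a₃ b)))))
    (hI : ∀ (n : ℕ) (w : Sym2 (Fin n) → unitInterval) (o b a₁ a₂ a₃ : Fin n), a₁ ≠ a₂ → a₁ ≠ a₃ → a₂ ≠ a₃ → o ≠ a₁ → o ≠ a₂ → o ≠ a₃ → b ≠ a₁ → b ≠ a₂ → b ≠ a₃ → o ≠ b → (prodBernoulli w).real (openConn a₃ b) ≤ (prodBernoulli w).real (openConn a₁ b) → (prodBernoulli w).real (openConn a₃ b) ≤ (prodBernoulli w).real (openConn a₂ b) → ((prodBernoulli w).real ((openConn a₁ a₂)ᶜ ∩ (openConn a₁ a₃)ᶜ ∩ (openConn a₂ a₃)ᶜ ∩ openConn a₁ o) + (prodBernoulli w).real ((openConn a₁ a₂)ᶜ ∩ (openConn a₁ a₃)ᶜ ∩ (openConn a₂ a₃)ᶜ ∩ openConn a₂ o)) * ((prodBernoulli w).real ((openConn a₁ a₃)ᶜ ∩ (openConn a₂ a₃)ᶜ ∩ (openConn a₁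 b ∩ openConn a₂ b)) - (prodBernoulli w).real ((openConn a₁ a₃)ᶜ ∩ (openConn a₂ a₃)ᶜ ∩ openConn a₃ b)) ≤ (prodBernoulli w).real ((openConn a₁ a₂)ᶜ ∩ (openConn a₁ a₃)ᶜ ∩ (openConn a₂ a₃)ᶜ : Set (BondConfig (Fin n))) * ((prodBernoulli w).real ((openConn a₁ a₃)ᶜ ∩ (openConn a₂ a₃)ᶜ ∩ ((openConn a₁ o ∪ openConn a₂ o) ∩ (openConn a₁ b ∩ openConn a₂ b))) - (prodBernoulli w).real ((openConn a₁ a₃)ᶜ ∩ (openConn a₂ a₃)ᶜ ∩ ((openConn a₁ o ∪ openConn a₂ o) ∩ openConn a₃ b))))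
    {n : ℕ} (w : Sym2 (Fin n) → unitInterval) (o b a₁ a₂ a₃ : Fin n)
    (h12 : a₁ ≠ a₂) (h13 : a₁ ≠ a₃) (h23 : a₂ ≠ a₃) (ho1 : o ≠ a₁) (ho2 : o ≠ a₂) (ho3 : o ≠ a₃)
    (hb1 : b ≠ a₁) (hb2 : b ≠ a₂) (hb3 : b ≠ a₃) (hob : o ≠ b)
    (hM : 0 < (prodBernoulli w).real ((openConn a₁ a₂)ᶜ ∩ (openConn a₁ a₃)ᶜ ∩ (openConn a₂ a₃)ᶜ : Set (BondConfig (Fin n))))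
    (hτ₁ : (prodBernoulli w).real (openConn a₃ b) ≤ (prodBernoulli w).real (openConn a₁ b))
    (hτ₂ : (prodBernoulli w).real (openConn a₃ b) ≤ (prodBernoulli w).real (openConn a₂ b)) :
    (prodBernoulli w).real ((openConn o a₁ ∪ openConn o a₂ ∪ openConn o a₃) ∩ openConn a₃ b) ≤
      (prodBernoulli w).real ((openConn o a₁ ∪ openConn o a₂ ∪ openConn o a₃) ∩ openConn o b) := by
  have hS1 := hSigma n w o b a₁ a₂ a₃ h12 h13 h23 ho1 ho2 ho3 hb1 hb2 hb3 hob
  have hS2 := hSigma n w o b a₂ a₁ a₃ h12.symm h23 h13 ho2 ho1 ho3 hb2 hb1 hb3 hob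
  have eM : ((openConn a₂ a₁)ᶜ ∩ (openConn a₂ a₃)ᶜ ∩ (openConn a₁ a₃)ᶜ : Set (BondConfig (Fin n))) =
      (openConn a₁ a₂)ᶜ ∩ (openConn a₁ a₃)ᶜ ∩ (openConn a₂ a₃)ᶜ := by
    ext ω
    simp only [Set.mem_inter_iff, Set.mem_compl_iff, knThm2_mem_openConn]
    constructor
    · rintro ⟨⟨h21, h23'⟩, h13'⟩
      exact ⟨⟨fun h => h21 h.symm, h13'⟩, h23'⟩
    · rintro ⟨⟨h12', h13'⟩, h23'⟩
      exact ⟨⟨fun h => h12' h.symm, h23'⟩, h13'⟩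
  rw [eM] at hS2
  exact preFKG3_of_claimI_sigma w o b a₁ a₂ a₃ h12 h13 h23 hM hτ₁ hτ₂
    (hI n w o b a₁ a₂ a₃ h12 h13 h23 ho1 ho2 ho3 hb1 hb2 hb3 hob hτ₁ hτ₂) hS1 hS2

end

end Summit.CriticalPhenomena.PercolationContinuityZ3.Theorems
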